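import Summits.BirchSwinnertonDyer.BirchSwinnertonDyer.Theorems.PrintCf2RamifiedOffTYZGenusKernelForm
import Literature.NumberTheory.EllipticCurves.Smith2016.CongruentNumberGenusDeterminantRowSix
import Literature.NumberTheory.EllipticCurves.CongruentNumberMonskySelmerParitySelmer
import Literature.NumberTheory.EllipticCurves.LFunctionSmulProofs
import Summits.BirchSwinnertonDyer.Rank1Residual.WAll.TargetCMTwoRamifiedRhoSix
import Summits.BirchSwinnertonDyer.Rank1Residual.P2.CongruentNumberPairsAtTwoRankOneGenus
import HarnessLib

/-!
# Route `PrintCf2`, crux stmt-BirchSwinnertonDyer-20509 `RamifiedOffTYZOfFacts` — THE FLAG-FREE ρ-SIX LEAF IS EMPTY: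
# for square-free `n ≡ 6 (mod 8)` on the rank-one leaf, `Σ₂′(n)` odd forces `ρ(n) = 1`
# (cell `bsd-print-cf2`, seat p2 «2-descent matrix road», g4; file 2 of 2)

HONEST FRAMING (cell `bsd-print-cf2`, HOME `run/shared/lean/pub/bsd-print-cf2/`; crux 20509 =
`𝔅_ram → WAllCornerFTwoRamifiedOffTYZProved`, OPEN): THEOREMS ONLY — no definition, no named fact, nothing asserted,
nothing booked. File 1 (`PrintCf2RamifiedOffTYZGenusKernelForm.lean`, p567656) proved, relative to the per-tuple row-6
identity of A. Smith's Theorem 2.2, that for `n = 2p₁⋯p_k` with Monsky kernel `{0, (β; α)}` the second genus sum of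
Tian–Yuan–Zhang is `Σ₂′(n) ≡ Σ_{pᵢ ≡ 3 (4)} βᵢ (mod 2)`, whence `Σ₂′(n)` odd and `Ш(E_n)[2^∞] = 0` give `ρ(n) ≥ 1`. The
row-6 identity is now a TREE THEOREM for every `k` — `Smith2016.genusSum₂'_two_mul_eq_border_adjugate_six` (cell
`bsd-monsky`, prover-B, `Literature/…/Smith2016/CongruentNumberGenusDeterminantRowSix.lean`), together with Smith's
Prop. 3.2 at `x = 6`, `Σ₂′(n)` odd ⟹ `#Sel₂(E_n) = 8` (`…card_selmerGroup_two_eq_eight_of_odd_genusSum₂'_six'`) — so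
the consequences are UNCONDITIONAL but for Gross–Zagier–Kolyvagin (`hGZK`, conjunct 1 of `𝔅_ram`) where rank one is
needed:

* `rhoIndex_ne_one_of_odd_genusSum₂'` — square-free `n ≡ 6 (8)`, `Σ₂′(n)` odd, `Ш(E_n)[2^∞] = 0` ⟹ `ρ(n) ≠ 0`
  (every number of prime factors; NO fact);
* `rhoIndex_ne_one_of_analyticRank_eq_one_six (hGZK)` — square-free `n ≡ 6 (8)`, `ord_{s=1} L(E_n, s) = 1`, `Σ₂′(n)`
  odd ⟹ `ρ(n) ≠ 0` (GZK: rank `1`; `#Sel₂ = 8` by Smith ⟹ `Ш[2^∞] = 0`);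
* `not_congruentTYZRhoSixFamily (hGZK)` — NO globally minimal curve of analytic rank one lies in p1's family
  `CongruentTYZRhoSixFamily` (`n ≡ 6 (8)`, `#Sel₂(E_n) = 8`, `ρ(n) = 0`, `Σ₂′(n)` odd; `WAll/TargetCMTwoRamifiedRhoSix.lean`,
  p547613): the membership is CONTRADICTORY on the leaf;
* `wAllCornerFTwoRamifiedTYZRhoSix_of_GZK (hGZK)` — hence the flag-free leaf `WAllCornerFTwoRamifiedTYZRhoSix` holds
  VACUOUSLY modulo GZK alone: it books NO curve (its in-bundle closer `wAllCornerFTwoRamifiedTYZRhoSix_of_facts (h12) (hGZK)`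
  of `PrintCf2RamifiedOffTYZRhoSixLeaf.lean` used TYZ Thm 1.2′ idly). p1's empirical caveat there («ρ(n) = 1 in all 166
  determined cases») is now a theorem; kit j289618 (n ≤ 3·10⁶): 182 600 members with `s = 1`, `Σ₂′` odd, `β ≠ 0` in all.

READING FOR THE CELL: Tian–Yuan–Zhang 2017 Thm 1.2 AS PRINTED, clause `n ≡ 6 (mod 8)` — `2^{ρ(n)+1} ∣ 𝓛(n) ⟹ Σ₂′(n)`
even, i.e. `ord₂ 𝓛(n) ≤ ρ(n)` when `Σ₂′(n)` is odd — never pins `ord₂ 𝓛(n) = 0` for an even `n` on the rank-one leaf,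
because there `ρ(n) = 1` exactly when the clause speaks. The genus-odd even members of the congruent family are closed
by name ONLY through the U⁺ display (`tyz_genusPointData`, LITERAL, aside 20471) or the theta road (asides 21185 /
21427 / 21428); the flag-free TYZρ door is confined to ODD `n` — by theorem, not by census. Beyond print: YES (not in
TYZ 2017 / Tian ICM 2022 Thm 13 / Smith 2016 / Heath-Brown–Monsky 1994). PARTITION: 0 cells moved; the booked-by-name
sub-cell «ρ-six» has 0 members.

## References

* [TianYuanZhang2017] Y. Tian, X. Yuan, S.-W. Zhang, Asian J. Math. 21 (2017) = arXiv:1411.4728, §1 (ρ(n), (1.1)),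
  Thm. 1.2 (`n ≡ 6` clause), Thm. 3.5.
* [Tian2023CongruentICM] Y. Tian, Proc. ICM 2022, Thm. 8 (p. 1996), Thm. 13 (pp. 2000–2001).
* [Smith2016CongruentDensity] A. Smith, arXiv:1603.08479v2, Thm. 2.2 row 6 (Table 2), Prop. 3.2.
* [HeathBrown1994SelmerCongruentII] D. R. Heath-Brown, Invent. Math. 118 (1994), Appendix (P. Monsky), typescript
  p. 41 L20–L36.
* [SilvermanAEC2009] J. H. Silverman, AEC 2nd ed., Thm. X.4.2.
-/

noncomputable section

open scoped Classical

open Matrix Finset WeierstrassCurve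
open Literature.NumberTheory.EllipticCurves
open Literature.NumberTheory.EllipticCurves.HeathBrown1994
open Literature.NumberTheory.EllipticCurves.TianYuanZhang2017
open Literature.NumberTheory.EllipticCurves.TianYuanZhang2017.RhoMonskyKernel
open Literature.NumberTheory.EllipticCurves.Rank1Residual
open Literature.NumberTheory.EllipticCurves.Smith2016

set_option autoImplicit false

namespace Summit.BirchSwinnertonDyer.PrintCf2

/-! ## §1 `Σ₂′(n)` odd forces `ρ(n) ≠ 0` (tuple-free; no fact) -/

/-- **THE UNIFORM ρ-THEOREM, tuple-free, NO FACT.** Square-free `n ≡ 6 (mod 8)` with `Σ₂′(n)` odd (Tian–Yuan–Zhang's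
second genus sum over `K_d = GenusField d`) and `Ш(E_n)[2^∞] = 0`: then `ρ(n) ≠ 0`, i.e.
`[E_n(ℚ) : φ_n(A_n(ℚ)) + E_n[2]] ≠ 1`. Ingredients, all tree theorems: Smith Thm 2.2 row 6 + Prop 3.2 (`Σ₂′` odd ⟹
`#Sel₂ = 8`, cell `bsd-monsky`), Monsky's `#Sel₂ = 2^{2+s}` (even case), file 1's `Σ₂′ ≡ t·β`, and the sharpness
theorem `rhoIndex_ne_one_of_kernelVector_even`. [cite: TianYuanZhang2017, §1 (ρ(n)) and Thm. 1.2 (n ≡ 6 clause)]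
[cite: Smith2016CongruentDensity, Thm. 2.2 row 6 and Prop. 3.2] [cite: HeathBrown1994SelmerCongruentII, Appendix (Monsky), typescript p. 41 L20–L36]
[cite: SilvermanAEC2009, Thm. X.4.2] -/
theorem rhoIndex_ne_one_of_odd_genusSum₂' {n : ℕ} (hsq : Squarefree n) (h8 : n % 8 = 6)
    (hgen : Odd (genusSum₂' n fun d => genusClassNumber (GenusField d)))
    (hsha : haveI := isElliptic_congruentNumberCurve hsq.ne_zero;
      AddCommGroup.primaryComponent (congruentNumberCurve n).sha 2 = ⊥) :
    (rhoSubgroup n).index ≠ 1 := by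
  have heven : Even n := Nat.even_iff.mpr (by omega)
  obtain ⟨k, p, hp, hp2, hinj, hprod⟩ := MonskySelmerParity.exists_odd_prime_family_of_squarefree_even hsq heven
  have hodd : ∀ i, Odd (p i) := fun i => (hp i).odd_of_ne_two (hp2 i)
  subst hprod
  have h4 : (∏ i, p i) % 4 = 3 := by omega
  have hsel : Nat.card ((congruentNumberCurve (2 * ∏ i, p i)).selmerGroup 2) = 8 :=
    card_selmerGroup_two_eq_eight_of_odd_genusSum₂'_six p hp hodd hinj h4 hgen
  -- `#Sel₂ = 2^{2+s}` ⟹ `s = 1` ⟹ two-element kernel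
  have hs : monskySelmerRankEven p = 1 := by
    have h := monsky_card_selmerGroup_two_even_holds k p hp hodd hinj
    rw [hsel] at h
    have h' : (2 : ℕ) ^ 3 = 2 ^ (2 + monskySelmerRankEven p) := by rw [← h]; norm_num
    have := Nat.pow_right_injective (le_refl 2) h'
    omega
  have hker : Fintype.card {v : Fin k ⊕ Fin k → ZMod 2 // monskyMatrixEven p *ᵥ v = 0} = 2 := by
    have hcard := natCard_ker_mulVecLin_eq (monskyMatrixEven p)
    rw [Nat.card_congr (Equiv.subtypeEquivRight (q := fun v => monskyMatrixEven p *ᵥ v = 0)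
      fun v => by rw [LinearMap.mem_ker, Matrix.mulVecLin_apply]), Nat.card_eq_fintype_card,
      Fintype.card_sum, Fintype.card_fin] at hcard
    rw [hcard]
    have hr : (monskyMatrixEven p).rank ≤ k + k := by
      have := Matrix.rank_le_card_width (monskyMatrixEven p)
      simpa [Fintype.card_sum, Fintype.card_fin] using this
    unfold monskySelmerRankEven at hs
    have : k + k - (monskyMatrixEven p).rank = 1 := by omega
    rw [this, pow_one]
  exact rhoIndex_ne_one_of_odd_genusSum₂'_of_row6 p hp hp2 hinj
    (genusSum₂'_two_mul_eq_border_adjugate_six p hp hodd hinj h4) hker hgen hsha rfl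

/-! ## §2 On the rank-one leaf (modulo GZK): `ρ(n) ≠ 0`, the ρ-six family is empty, the ρ-six leaf is vacuous -/

/-- **No rank-one `E_n` with `n ≡ 6 (mod 8)` and `Σ₂′(n)` odd has `ρ(n) = 0`** (modulo GZK only): for square-free
`n ≡ 6 (8)` with `ord_{s=1} L(E_n, s) = 1` and `Σ₂′(n)` odd, `ρ(n) ≠ 0`. (GZK: rank `1`; Smith: `#Sel₂ = 8`; hence
`Ш(E_n)[2^∞] = 0` and §1 applies.) So TYZ Thm 1.2's `n ≡ 6` clause (`ord₂ 𝓛(n) ≤ ρ(n)` when `Σ₂′` is odd) never pins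
`ord₂ 𝓛(n) = 0` on the leaf. [cite: TianYuanZhang2017, Thm. 1.2 (n ≡ 6 clause) and §1 (ρ(n), (1.1))]
[cite: Tian2023CongruentICM, Thm. 13 (pp. 2000–2001)] [cite: Smith2016CongruentDensity, Thm. 2.2 row 6, Prop. 3.2]
[cite: SilvermanAEC2009, Thm. X.4.2] -/
theorem rhoIndex_ne_one_of_analyticRank_eq_one_six (hGZK : rank_eq_analyticRank_of_analyticRank_le_one) {n : ℕ}
    (hsq : Squarefree n) (h8 : n % 8 = 6)
    (hr1 : haveI := isElliptic_congruentNumberCurve hsq.ne_zero; (congruentNumberCurve n).analyticRank = 1)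
    (hgen : Odd (genusSum₂' n fun d => genusClassNumber (GenusField d))) :
    (rhoSubgroup n).index ≠ 1 := by
  haveI := isElliptic_congruentNumberCurve hsq.ne_zero
  have hsel : Nat.card ((congruentNumberCurve n).selmerGroup 2) = 8 :=
    card_selmerGroup_two_eq_eight_of_odd_genusSum₂'_six' hsq h8 hgen
  obtain ⟨hrank, -⟩ := hGZK (congruentNumberCurve n) (le_of_eq hr1)
  rw [hr1] at hrank
  have hbot := Rank1Residual.P2.primaryComponent_sha_two_eq_bot_of_card_selmerGroup_eq_eight hsq.ne_zero hrank hsel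
  exact rhoIndex_ne_one_of_odd_genusSum₂' hsq h8 hgen hbot

/-- **THE ρ-SIX FAMILY IS EMPTY ON THE RANK-ONE LEAF** (modulo GZK only): no globally minimal `W` of analytic rank one is
a `ℚ`-model of an `E_n` with `n ≡ 6 (mod 8)` square-free, `#Sel₂(E_n) = 8`, `ρ(n) = 0` and `Σ₂′(n)` odd — the
membership predicate `CongruentTYZRhoSixFamily` of `WAll/TargetCMTwoRamifiedRhoSix.lean` (p547613) is contradictory
there (`r_an(E_n) = r_an(W) = 1` by isomorphism invariance, then `rhoIndex_ne_one_of_analyticRank_eq_one_six`).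
[cite: TianYuanZhang2017, Thm. 1.2 (n ≡ 6 clause) and §1 (ρ(n))] [cite: Smith2016CongruentDensity, Thm. 2.2 row 6, Prop. 3.2]
[cite: SilvermanAEC2009, Thm. X.4.2] -/
theorem not_congruentTYZRhoSixFamily (hGZK : rank_eq_analyticRank_of_analyticRank_le_one)
    (W : WeierstrassCurve ℚ) [W.IsElliptic] [W.IsGloballyMinimal] (hr : W.analyticRank = 1) :
    ¬ CongruentTYZRhoSixFamily W := by
  rintro ⟨n, hsq, h8, -, hρ, hgen, C, hC⟩
  haveI := isElliptic_congruentNumberCurve hsq.ne_zero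
  have hr1 : (congruentNumberCurve n).analyticRank = 1 := by
    rw [← analyticRank_smul (congruentNumberCurve n) C]
    subst hC
    convert hr
  exact rhoIndex_ne_one_of_analyticRank_eq_one_six hGZK hsq h8 hr1 hgen hρ

/-- **The flag-free leaf `WAllCornerFTwoRamifiedTYZRhoSix` holds VACUOUSLY modulo GZK alone** — it books no curve
(supersedes the in-bundle closer `wAllCornerFTwoRamifiedTYZRhoSix_of_facts (h12) (hGZK)`, whose TYZ input is idle).
[cite: TianYuanZhang2017, Thm. 1.2 (n ≡ 6 clause)] [cite: Smith2016CongruentDensity, Thm. 2.2 row 6, Prop. 3.2] -/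
theorem wAllCornerFTwoRamifiedTYZRhoSix_of_GZK (hGZK : rank_eq_analyticRank_of_analyticRank_le_one) :
    WAllCornerFTwoRamifiedTYZRhoSix :=
  fun W _ _ _ hr _ hmem => (not_congruentTYZRhoSixFamily hGZK W hr hmem).elim

end Summit.BirchSwinnertonDyer.PrintCf2

end
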